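import Summits.ABC.ABC.Theorems.PrimePowerRadical.Negative.WieferichSparse

/-!
# Calibration of the level-2 milestone: a square-divisor bound below `1/2` gives the crux at `q`

Stub `stub_PPRAt_of_sqDivisorBound` of the line `nevbir-below-beta` for the crux
`Summit.ABC.ABC.Theses.IneffectiveSubspace.PrimePowerRadical` (stmt-ABC-1648; abc on the family
`(1, q^k − 1, q^k)`: `q^k < C · rad(1·(q^k−1)·q^k)^{1+ε}` with a constant per prime `q`).

We prove (`stub_PPRAt_of_sqDivisorBound`): for a prime `q` and `μ < 1/2`, a SQUARE-DIVISOR BOUND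
`u² ∣ q^k − 1 ⟹ u ≤ C · q^{μk}` (all `k ≥ 1`) implies the crux at `q` for every FIXED exponent
`ε > 2μ/(1 − 2μ)`. (This is the elementary calibration turning the level-2 milestone of the line,
`sqDivisorBound_of_level2`, into the crux at `q`; the hypothesis `0 ≤ μ` of the registered signature
is not needed and is kept as `_hμ0`.)

Proof. Write `m := q^k − 1 = u² · a` with `a` squarefree (`Nat.sq_mul_squarefree`); `a` is a radical
element dividing `m ≠ 0`, so `a ∣ radical m`, whence `u² ∣ m` and `m ≤ radical(m) · u²`
(`sqdb_exists_sq_dvd`: the powerful excess `m / radical m` is at most the square of the maximal square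
divisor). With `C₀ := max C 1` the bound gives `u² ≤ C₀² q^{2μk}`, and `q^k ≤ 2m`, so
`q^k ≤ D · q^{2μk} · radical(m)` with `D := 2 C₀²` (`sqdb_pow_le`), i.e. `radical(m) ≥ q^{(1−2μ)k}/D`.
Now `rad(1·(q^k−1)·q^k) = radical(m) · q ≥ radical(m)` (`Negative.rad_family_eq`) and
`(1 − 2μ)(1 + ε) ≥ 1` (this is `ε > 2μ/(1−2μ)`, as `1 − 2μ > 0`), so
`(radical(m) · q)^{1+ε} ≥ q^{(1−2μ)(1+ε)k}/D^{1+ε} ≥ q^k/D^{1+ε}`, and `C := D^{1+ε} + 1` works (the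
final step is strict because `(radical(m) · q)^{1+ε} > 0`). The `rpow` bookkeeping follows
`Negative.PPRAt_of_wieferichSparse`.

Sources: the checked skeleton `Cruxes/PrimePowerRadical/Lines/nevbir_below_beta.lean` (milestone chain
`sqDivisorBound_of_level2` → `stub_PPRAt_of_sqDivisorBound` → `ladderRung_of_level2`); folklore.
Deliberately NOT here: the square-divisor bound itself (it is what the level-2 bet
`stub_level2_beyondLiouville` of the line would deliver), and every other stub of the line.
-/

noncomputable section

-- `Summit.<Summit>.<Problem>` is the mandated summit-side namespace (CONVENTIONS §2); for the
-- single-conjunct summit `ABC` the two coincide, so the duplicate `ABC.ABC` is deliberate.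
set_option linter.dupNamespace false

namespace Summit.ABC.ABC.Theorems.PrimePowerRadical.NevbirBelowBeta

open Literature.NumberTheory.DiophantineGeometry UniqueFactorizationMonoid
open Summit.ABC.ABC.Theses.IneffectiveSubspace
open Summit.ABC.ABC.Theorems.PrimePowerRadical.Negative

/-- Every `m ≠ 0` has a square divisor `u² ∣ m` with `m ≤ radical(m) · u²`: write `m = u² · a` with
`a` squarefree; then `a ∣ m` and `a` is a radical element, so `a ∣ radical m`. -/
theorem sqdb_exists_sq_dvd {m : ℕ} (hm : m ≠ 0) :
    ∃ u : ℕ, u ^ 2 ∣ m ∧ m ≤ radical m * u ^ 2 := by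
  obtain ⟨a, u, hua, ha⟩ := Nat.sq_mul_squarefree m
  refine ⟨u, Dvd.intro _ hua, ?_⟩
  have hadvd : a ∣ m := Dvd.intro_left _ hua
  have hle : a ≤ radical m :=
    Nat.le_of_dvd (Nat.radical_pos m) ((dvd_radical_iff ha.isRadical hm).mpr hadvd)
  calc m = u ^ 2 * a := hua.symm
    _ ≤ u ^ 2 * radical m := Nat.mul_le_mul_left _ hle
    _ = radical m * u ^ 2 := mul_comm _ _

/-- Under a square-divisor bound `u² ∣ q^k − 1 ⟹ u ≤ C₀ · q^{μk}` at a fixed `k ≥ 1` (`q` prime):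
`q^k ≤ 2 C₀² · q^{2μk} · radical(q^k − 1)` — the powerful excess of `q^k − 1` is at most the square of
its maximal square divisor, and `q^k ≤ 2 (q^k − 1)`. -/
theorem sqdb_pow_le {q k : ℕ} (hq : q.Prime) (hk : 1 ≤ k) {C₀ μ : ℝ}
    (hu : ∀ u : ℕ, u ^ 2 ∣ q ^ k - 1 → (u : ℝ) ≤ C₀ * (q : ℝ) ^ (μ * k)) :
    (q : ℝ) ^ k ≤ 2 * C₀ ^ 2 * (q : ℝ) ^ (2 * μ * k) * ((radical (q ^ k - 1) : ℕ) : ℝ) := by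
  have h2 := two_le_pow hq.two_le hk
  have hm : q ^ k - 1 ≠ 0 := by omega
  obtain ⟨u, hu2, hmle⟩ := sqdb_exists_sq_dvd hm
  have h3 : q ^ k ≤ 2 * (radical (q ^ k - 1) * u ^ 2) := by omega
  have h3R : (q : ℝ) ^ k ≤ 2 * (((radical (q ^ k - 1) : ℕ) : ℝ) * (u : ℝ) ^ 2) := by
    exact_mod_cast h3
  have hq0 : (0 : ℝ) ≤ q := Nat.cast_nonneg q
  have hsq : (u : ℝ) ^ 2 ≤ (C₀ * (q : ℝ) ^ (μ * k)) ^ 2 :=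
    pow_le_pow_left₀ (Nat.cast_nonneg u) (hu u hu2) 2
  have hQ : ((q : ℝ) ^ (μ * k)) ^ 2 = (q : ℝ) ^ (2 * μ * k) := by
    rw [← Real.rpow_natCast, ← Real.rpow_mul hq0]
    congr 1
    push_cast
    ring
  have hR0 : (0 : ℝ) ≤ ((radical (q ^ k - 1) : ℕ) : ℝ) := Nat.cast_nonneg _
  calc (q : ℝ) ^ k ≤ 2 * (((radical (q ^ k - 1) : ℕ) : ℝ) * (u : ℝ) ^ 2) := h3R
    _ ≤ 2 * (((radical (q ^ k - 1) : ℕ) : ℝ) * (C₀ * (q : ℝ) ^ (μ * k)) ^ 2) :=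
        mul_le_mul_of_nonneg_left (mul_le_mul_of_nonneg_left hsq hR0) (by norm_num)
    _ = 2 * C₀ ^ 2 * (q : ℝ) ^ (2 * μ * k) * ((radical (q ^ k - 1) : ℕ) : ℝ) := by
        rw [mul_pow, hQ]
        ring

/-- **stub_PPRAt_of_sqDivisorBound (calibration of the level-2 milestone of the line
`nevbir-below-beta`).** For a prime `q` and `μ < 1/2`, a square-divisor bound
`u² ∣ q^k − 1 ⟹ u ≤ C · q^{μk}` (all `k ≥ 1`) gives the crux `PrimePowerRadical` at the base `q` for
every FIXED `ε > 2μ/(1 − 2μ)`: `q^k ≤ D · q^{2μk} · radical(q^k − 1)` with `D = 2 max(C,1)²`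
(`sqdb_pow_le`), so `(q · radical(q^k − 1))^{1+ε} ≥ q^{(1−2μ)(1+ε)k}/D^{1+ε} ≥ q^k/D^{1+ε}` because
`(1 − 2μ)(1 + ε) ≥ 1`, and `C := D^{1+ε} + 1` works. The hypothesis `0 ≤ μ` is not used. -/
theorem stub_PPRAt_of_sqDivisorBound {q : ℕ} (hq : q.Prime) {μ : ℝ} (_hμ0 : 0 ≤ μ) (hμ : μ < 1 / 2)
    (h : ∃ C : ℝ, ∀ k : ℕ, 1 ≤ k → ∀ u : ℕ, u ^ 2 ∣ q ^ k - 1 → (u : ℝ) ≤ C * (q : ℝ) ^ (μ * k))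
    {ε : ℝ} (hε : 2 * μ / (1 - 2 * μ) < ε) :
    ∃ C : ℝ, 0 < C ∧ ∀ k : ℕ, 1 ≤ k →
      ((q ^ k : ℕ) : ℝ) < C * ((rad 1 (q ^ k - 1) (q ^ k) : ℕ) : ℝ) ^ (1 + ε) := by
  obtain ⟨C, hC⟩ := h
  have h12 : 0 < 1 - 2 * μ := by linarith
  have hε' : 2 * μ < ε * (1 - 2 * μ) := (div_lt_iff₀ h12).mp hε
  set t : ℝ := 1 + ε with ht
  have hkey : 1 ≤ (1 - 2 * μ) * t := by rw [ht]; linarith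
  have ht0 : 0 < t := by nlinarith
  have hq0 : (0 : ℝ) < q := by exact_mod_cast hq.pos
  have hq1 : (1 : ℝ) ≤ q := by exact_mod_cast hq.one_lt.le
  set C₀ : ℝ := max C 1 with hC₀
  have hC₀0 : 0 < C₀ := lt_of_lt_of_le one_pos (le_max_right _ _)
  set D : ℝ := 2 * C₀ ^ 2 with hD
  have hD0 : 0 < D := mul_pos two_pos (pow_pos hC₀0 2)
  refine ⟨D ^ t + 1, by positivity, fun k hk => ?_⟩
  rw [rad_family_eq hq hk]
  push_cast
  set R : ℝ := ((radical (q ^ k - 1) : ℕ) : ℝ) with hRdef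
  have hR0 : 0 < R := by rw [hRdef]; exact_mod_cast Nat.radical_pos _
  -- the square-divisor bound with the constant `C₀ = max C 1 > 0`
  have hu : ∀ u : ℕ, u ^ 2 ∣ q ^ k - 1 → (u : ℝ) ≤ C₀ * (q : ℝ) ^ (μ * k) := fun u hu2 =>
    (hC k hk u hu2).trans (mul_le_mul_of_nonneg_right (le_max_left _ _) (Real.rpow_nonneg hq0.le _))
  -- `q^k ≤ D · q^(2μk) · R`
  have h4 : (q : ℝ) ^ k ≤ D * (q : ℝ) ^ (2 * μ * k) * R := sqdb_pow_le hq hk hu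
  -- `R ≥ q^((1-2μ)k) / D`
  have hQ1 : (0 : ℝ) < (q : ℝ) ^ (2 * μ * k) := Real.rpow_pos_of_pos hq0 _
  have h6 : (q : ℝ) ^ ((1 - 2 * μ) * k) / D ≤ R := by
    rw [div_le_iff₀ hD0]
    have e : (q : ℝ) ^ ((1 - 2 * μ) * k) = (q : ℝ) ^ k / (q : ℝ) ^ (2 * μ * k) := by
      rw [eq_div_iff hQ1.ne', ← Real.rpow_natCast, ← Real.rpow_add hq0]
      ring_nf
    rw [e, div_le_iff₀ hQ1]
    linarith [h4]
  -- `(R q)^t ≥ (q^((1-2μ)k)/D)^t = q^((1-2μ) t k)/D^t ≥ q^k / D^t`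
  have hRq : R ≤ R * q := le_mul_of_one_le_right hR0.le hq1
  have h7 : ((q : ℝ) ^ ((1 - 2 * μ) * k) / D) ^ t ≤ (R * q) ^ t :=
    Real.rpow_le_rpow (by positivity) (h6.trans hRq) ht0.le
  have h8 : ((q : ℝ) ^ ((1 - 2 * μ) * k) / D) ^ t = (q : ℝ) ^ ((1 - 2 * μ) * t * k) / D ^ t := by
    rw [Real.div_rpow (by positivity) hD0.le, ← Real.rpow_mul hq0.le]
    congr 2
    ring
  have h9 : (q : ℝ) ^ k ≤ (q : ℝ) ^ ((1 - 2 * μ) * t * k) := by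
    rw [← Real.rpow_natCast]
    apply Real.rpow_le_rpow_of_exponent_le hq1
    have hk0 : (0 : ℝ) ≤ k := Nat.cast_nonneg k
    calc (k : ℝ) = 1 * k := (one_mul _).symm
      _ ≤ (1 - 2 * μ) * t * k := mul_le_mul_of_nonneg_right hkey hk0
  have hDt : 0 < D ^ t := Real.rpow_pos_of_pos hD0 t
  have h10 : (q : ℝ) ^ k ≤ D ^ t * (R * q) ^ t := by
    rw [h8, div_le_iff₀ hDt] at h7
    calc (q : ℝ) ^ k ≤ (q : ℝ) ^ ((1 - 2 * μ) * t * k) := h9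
      _ ≤ (R * q) ^ t * D ^ t := h7
      _ = D ^ t * (R * q) ^ t := mul_comm _ _
  have hRt : 0 < (R * q) ^ t := Real.rpow_pos_of_pos (mul_pos hR0 hq0) t
  calc (q : ℝ) ^ k ≤ D ^ t * (R * q) ^ t := h10
    _ < (D ^ t + 1) * (R * q) ^ t := by nlinarith

end Summit.ABC.ABC.Theorems.PrimePowerRadical.NevbirBelowBeta

end
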